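import Summits.NavierStokesRegularity.NavierStokesRegularity.Theses.AxisymmetricExtremality
import Literature.Analysis.FluidPDE.AxisymQuotientEquationsJ
import Literature.Analysis.FluidPDE.IsometryInvariance
import Literature.Analysis.FluidPDE.NewtonKernel
import Literature.Analysis.FluidPDE.SereginZajaczkowski2007L42VorticityProofs
import HarnessLib

/-!
# Seregin 2022, §2 Step 3 for the LOCAL smooth class (I): the vorticity right-hand side and the
# equation of `Γ = ω_θ/r` as an identity of smooth functions — crux stmt-NavierStokesRegularity-15453
# (`AxisymmetricExtremality.AxisymmetricKatoGlobal`), line registered, support for stub `stub_sereginLogSwirlOrigin`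

Support file (`--supports stmt-NavierStokesRegularity-15453`; theorems only, everything proved)
toward the registered stub `stub_sereginLogSwirlOrigin` = the named fact
`Literature.Analysis.FluidPDE.seregin2022_logSwirl_regularAtOrigin` (G. Seregin, J. Math. Fluid
Mech. 24 (2022), Paper 27 = arXiv:2201.00153, §2). Step 3 (arXiv p. 6) rests on the two equations
`∂ₜΦ + (v − 2x'/|x'|²)·∇Φ − ΔΦ − ω·∇(v_r/r) = 0`, `∂ₜΓ + (v − 2x'/|x'|²)·∇Γ − ΔΓ + 2(v_θ/r)Φ = 0`
(`Φ = ω_r/r`, `Γ = ω_θ/r`). The landed Step-3 chain (`…Step3Gamma` … `…Step3KeyUnconditional`)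
takes them from the tree's `IsClassicalNSSolutionOn.angVortQuot_eq` / `.radVelQuot_curl_eq`,
i.e. for WHOLE-SPACE classical solutions (velocity and pressure jointly `C^∞` on `S × ℝ³`, the
time derivative being `angVortQuot (∂ₜv)`). The final reduction of the fact
(`seregin2022_logSwirl_regularAtOrigin_of_cleanRepr`, `…FinalReduction`) however only provides a
representative `V` in the Seregin–Zajaczkowski class `IsSmoothAxisymmetricSolutionOn (parCylOpens ẑ R) V q`:
a suitable weak solution on an open cylinder whose slices are `C^∞` there with all SPATIAL
derivatives jointly continuous — no time derivative of `V`, no regular pressure. This file and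
its two sequels (`…Step3LocalEquationsPhi`, `…Step3LocalClass`) port the two equations to that
class.

The mechanism (no pressure, no `∂ₜV`): the tree's
`vorticity_classical_of_isDistributionalNSSolutionOn` gives for such a class, on any open
product `I × U` inside the cylinder, the CLASSICAL vorticity equation in the pointwise form
`d/ds (curl V(s))(x)|ₛ₌ₜ = W(t, x)`, `W = Δω − Dω[V] + DV[ω]`, `ω = curl V`. The whole content
of the `Γ`/`Φ` equations is then SPATIAL algebra at a fixed time — the computation inside the
proofs of `angVortQuot_eq_of_ne`, `radVelQuot_curl_eq_of_ne`, which uses the vorticity equation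
and axisymmetry only (not `div v = 0`, not the momentum equation). This file:

* `isAxisymmetric_vorticityRHS`, `contDiff_vorticityRHS` — for an axisymmetric `u ∈ C^∞(ℝ³)`
  the field `W = νΔω − Dω[u] + Du[ω]` is axisymmetric and `C^∞`, so its smooth quotients
  `angVelQuot W = radQuot (swirl W)` ("`∂ₜΓ`") and `radVelQuot W` ("`∂ₜΦ`") make sense
  (`laplacian_conj_linearIsometryEquiv`, `convect_conj_linearIsometryEquiv`);
* `angVelQuot_vorticityRHS_eq_of_ne`, `angVelQuot_vorticityRHS_eq` (registered sub-goal) —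
  **the `Γ`-equation as an identity of smooth functions on `ℝ³`**:
  `angVelQuot W + DΓ[u] = ν(ΔΓ + 2q_Γ) − 2(u_θ/r)Φ` everywhere
  (`Γ = angVortQuot u`, `Φ = radVelQuot (curl u)`, `u_θ/r = angVelQuot u`, `q = radDerivQuot`,
  `2q_Γ = (2x'/|x'|²)·∇Γ`). Off the axis it is the algebra of `angVortQuot_eq_of_ne` with
  `∂ₜ swirl ω` replaced by `swirl W = ⟪Jx, W⟫`
  (`⟪Jx, W⟫ + D(swirl ω)[u] = 2⟪Ju, ω⟫ + ν⟪Jx, Δω⟫`); on the axis by continuity.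

The sequels prove the `Φ`-equation, the identification `∂ₜΓ = angVelQuot W`,
`∂ₜΦ = radVelQuot W` off the axis along a family whose vorticity time lines solve the vorticity
equation, and the specialisation to the Seregin–Zajaczkowski class.

## Mathlib / tree search

Tree: the algebra of `IsClassicalNSSolutionOn.angVortQuot_eq_of_ne` (`AxisymQuotientEquationsOmega`:
`laplacian_swirl`, `IsAxisymmetric.partialDeriv_eR_swirl`, `cylRadius_sq_mul_inner_rotGen`,
`template_quotient_eq`, `fderiv_apply_horizontal_eq`, `eq_of_eq_off_ker`), `fderiv_swirl_apply`,
`IsAxisymmetric.inner_rotGen_convect_curl`, `laplacian_conj_linearIsometryEquiv`,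
`convect_conj_linearIsometryEquiv` (`IsometryInvariance`; the tree's `IsAxisymmetric.laplacian_rotZ`,
`.convect_rotZ` in `KNSSSwirlFromVorticity` are the one-field cases), `contDiff_laplacian`
(`NewtonKernel`), `IsAxisymmetric.cylRadius_sq_mul_angVelQuot / _angVortQuot / _radVelQuot`
(`AxisymHouLiVariables`), `SereginZajaczkowski2007.inner_horizontal_left` (`…L42VorticityProofs`). `lean search 'vorticityRHS' --decl`: only the unrelated
`inv_cylRadius_mul_inner_rotGen_vorticityRHS` (SZ2007 (4.5) on an off-axis shell),
`inner_vorticityRHS_eq`, `enstrophyC2_norm_iteratedFDeriv_vorticityRHS_le` (2026-08-17).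

## References

* G. Seregin, J. Math. Fluid Mech. 24 (2022), Paper No. 27 = arXiv:2201.00153, §2 Step 3
  (arXiv p. 6, the equations of `Φ` and `Γ`). [`Seregin2022LocalAxisym`]
* Z. Lei, Q. S. Zhang, Pacific J. Math. 289 (2017) = arXiv:1505.02628, (1.4). [`LeiZhang2017`]
-/

noncomputable section

open MeasureTheory Set Function Filter Topology InnerProductSpace WithLp
open scoped RealInnerProductSpace Laplacian ContDiff
open Literature.Analysis.FluidPDE

-- `<Problem> = <Summit>` duplicates a namespace component by design (lakefile sets the same option).
set_option linter.dupNamespace false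

namespace Summit.NavierStokesRegularity.NavierStokesRegularity.Theorems.AxisymmetricKatoGlobal.EulerScaling

/-! ### The vorticity right-hand side `W = νΔω − Dω[u] + Du[ω]` of an axisymmetric field -/

section RHS

variable {u : EuclideanSpace ℝ (Fin 3) → EuclideanSpace ℝ (Fin 3)}

/-- The Laplacian of an axisymmetric vector field is axisymmetric
(`laplacian_conj_linearIsometryEquiv`). [folklore] -/
theorem laplacian_rotZ_of_isAxisymmetric (hax : IsAxisymmetric u) (θ : ℝ)
    (y : EuclideanSpace ℝ (Fin 3)) : (Δ u) (rotZ θ y) = rotZ θ ((Δ u) y) := by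
  have hconj : (fun z => rotZLIE θ (u ((rotZLIE θ).symm z))) = u :=
    funext fun z => by simp [hax.rotZ_apply_rotZ_neg θ z]
  have h := laplacian_conj_linearIsometryEquiv (rotZLIE θ) u (rotZLIE θ y)
  rw [hconj, LinearIsometryEquiv.symm_apply_apply] at h
  simpa using h

/-- The convective derivative `Dw[u]` of two axisymmetric vector fields is axisymmetric
(`convect_conj_linearIsometryEquiv`). [folklore] -/
theorem convect_rotZ_of_isAxisymmetric {w : EuclideanSpace ℝ (Fin 3) → EuclideanSpace ℝ (Fin 3)}
    (hax : IsAxisymmetric u) (hw : IsAxisymmetric w) (θ : ℝ) (y : EuclideanSpace ℝ (Fin 3)) :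
    convect u w (rotZ θ y) = rotZ θ (convect u w y) := by
  have hcu : (fun z => rotZLIE θ (u ((rotZLIE θ).symm z))) = u :=
    funext fun z => by simp [hax.rotZ_apply_rotZ_neg θ z]
  have hcw : (fun z => rotZLIE θ (w ((rotZLIE θ).symm z))) = w :=
    funext fun z => by simp [hw.rotZ_apply_rotZ_neg θ z]
  have h := convect_conj_linearIsometryEquiv (rotZLIE θ) u w (rotZLIE θ y)
  rw [hcu, hcw, LinearIsometryEquiv.symm_apply_apply] at h
  simpa using h

/-- **The vorticity right-hand side of an axisymmetric field is axisymmetric**: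
`W = νΔω − Dω[u] + Du[ω]`, `ω = curl u`, satisfies `W (R_θ y) = R_θ (W y)`. [folklore] -/
theorem isAxisymmetric_vorticityRHS (hax : IsAxisymmetric u) (hu : ContDiff ℝ 1 u) (ν : ℝ) :
    IsAxisymmetric fun y => ν • (Δ (curl u)) y - fderiv ℝ (curl u) y (u y) +
      fderiv ℝ u y (curl u y) := by
  have haxω : IsAxisymmetric (curl u) := hax.curl (hu.differentiable one_ne_zero)
  intro θ y
  have h1 := laplacian_rotZ_of_isAxisymmetric haxω θ y
  have h2 := convect_rotZ_of_isAxisymmetric hax haxω θ y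
  have h3 := convect_rotZ_of_isAxisymmetric haxω hax θ y
  rw [convect_apply, convect_apply] at h2 h3
  show ν • (Δ (curl u)) (rotZ θ y) - fderiv ℝ (curl u) (rotZ θ y) (u (rotZ θ y)) +
      fderiv ℝ u (rotZ θ y) (curl u (rotZ θ y)) = rotZ θ _
  rw [h1, h2, h3, ← rotZL_apply, ← rotZL_apply, ← rotZL_apply, ← rotZL_apply, map_add, map_sub,
    map_smul]

/-- The vorticity right-hand side of a `C^∞` field is `C^∞`. [folklore] -/
theorem contDiff_vorticityRHS (hu : ContDiff ℝ ∞ u) (ν : ℝ) :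
    ContDiff ℝ ∞ fun y => ν • (Δ (curl u)) y - fderiv ℝ (curl u) y (u y) +
      fderiv ℝ u y (curl u y) := by
  have hω : ContDiff ℝ ∞ (curl u) := contDiff_curl (n := ⊤) (by exact_mod_cast hu)
  have hΔ : ContDiff ℝ ∞ (Δ (curl u)) := contDiff_laplacian (n := ⊤) (by exact_mod_cast hω)
  have h1 : ContDiff ℝ ∞ (fderiv ℝ (curl u)) := hω.fderiv_right (m := ∞) (by simp)
  have h2 : ContDiff ℝ ∞ (fderiv ℝ u) := hu.fderiv_right (m := ∞) (by simp)
  exact ((hΔ.const_smul ν).sub (h1.clm_apply hu)).add (h2.clm_apply hω)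

end RHS

/-! ### The `Γ`- and `Φ`-equations as identities of smooth functions (fixed time) -/

section SliceEquations

variable {u : EuclideanSpace ℝ (Fin 3) → EuclideanSpace ℝ (Fin 3)}

/-- **The `Γ`-equation off the axis, slice form**: with `W = νΔω − Dω[u] + Du[ω]`,
`angVelQuot W x + DΓ(x)[u x] = ν (ΔΓ(x) + 2 q_Γ(x)) − 2 (u_θ/r)(x) Φ(x)` for `cylRadius x ≠ 0`
(`Γ = angVortQuot u`, `Φ = radVelQuot (curl u)`). The algebra of
`IsClassicalNSSolutionOn.angVortQuot_eq_of_ne` with the time derivative `∂ₜ swirl ω` replaced by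
`swirl W = ⟪Jx, W⟫`: `⟪Jx, W⟫ + D(swirl ω)[u] = 2⟪Ju, ω⟫ + ν⟪Jx, Δω⟫` (`fderiv_swirl_apply`,
`IsAxisymmetric.inner_rotGen_convect_curl`), then Lagrange's identity, `laplacian_swirl` and the
template. [cite: Seregin2022LocalAxisym, §2 Step 3 (arXiv:2201.00153 p. 6, the equation of Γ)] -/
theorem angVelQuot_vorticityRHS_eq_of_ne (hu : ContDiff ℝ ∞ u) (hax : IsAxisymmetric u) (ν : ℝ)
    {x : EuclideanSpace ℝ (Fin 3)} (hx : cylRadius x ≠ 0) :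
    angVelQuot (fun y => ν • (Δ (curl u)) y - fderiv ℝ (curl u) y (u y) +
        fderiv ℝ u y (curl u y)) x + fderiv ℝ (angVortQuot u) x (u x) =
      ν * ((Δ (angVortQuot u)) x + 2 * radDerivQuot (angVortQuot u) x) -
        2 * angVelQuot u x * radVelQuot (curl u) x := by
  set W : EuclideanSpace ℝ (Fin 3) → EuclideanSpace ℝ (Fin 3) := fun y =>
    ν • (Δ (curl u)) y - fderiv ℝ (curl u) y (u y) + fderiv ℝ u y (curl u y) with hWdef
  -- regularity
  have hv2 : ContDiff ℝ 2 u := hu.of_le (by norm_cast)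
  have hv3 : ContDiff ℝ 3 u := hu.of_le (by norm_cast)
  have hv5 : ContDiff ℝ 5 u := hu.of_le (by norm_cast)
  have hvd : Differentiable ℝ u := hu.differentiable (by simp)
  have hω : ContDiff ℝ ∞ (curl u) := contDiff_curl (n := ⊤) (by exact_mod_cast hu)
  have hω2 : ContDiff ℝ 2 (curl u) := hω.of_le (by norm_cast)
  have hωd : Differentiable ℝ (curl u) := hω.differentiable (by simp)
  have haxω : IsAxisymmetric (curl u) := hax.curl hvd
  have hW : ContDiff ℝ ∞ W := contDiff_vorticityRHS hu ν
  have hW2 : ContDiff ℝ 2 W := hW.of_le (by norm_cast)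
  have hWax : IsAxisymmetric W := isAxisymmetric_vorticityRHS hax (hu.of_le (by norm_cast)) ν
  have hΩ : ContDiff ℝ 2 (angVortQuot u) := contDiff_angVortQuot (n := 2) hv5
  have hΩax : IsAxisymmetricScalar (angVortQuot u) := hax.isAxisymmetricScalar_angVortQuot hv3
  have hρx : x 0 ^ 2 + x 1 ^ 2 ≠ 0 := by
    rwa [sq_add_sq_eq_cylRadius_sq, pow_ne_zero_iff two_ne_zero]
  -- (i) the "time derivative": `ρ · angVelQuot W = swirl W = ⟪Jx, W⟫`, and the transport algebra
  have ht1 : (x 0 ^ 2 + x 1 ^ 2) * angVelQuot W x = ⟪rotGen x, W x⟫ := by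
    rw [sq_add_sq_eq_cylRadius_sq, hWax.cylRadius_sq_mul_angVelQuot hW2 x]
    exact congrFun (swirl_eq_inner_rotGen W) x
  have hpde : (x 0 ^ 2 + x 1 ^ 2) * angVelQuot W x + fderiv ℝ (swirl (curl u)) x (u x) =
      2 * ⟪rotGen (u x), curl u x⟫ + ν * ⟪rotGen x, (Δ (curl u)) x⟫ := by
    have hstr : ⟪rotGen x, fderiv ℝ u x (curl u x)⟫ = ⟪rotGen (u x), curl u x⟫ := by
      rw [← convect_apply]; exact hax.inner_rotGen_convect_curl (hvd x)
    have hWx : W x = ν • (Δ (curl u)) x - fderiv ℝ (curl u) x (u x) + fderiv ℝ u x (curl u x) :=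
      rfl
    rw [ht1, fderiv_swirl_apply (hωd x) (u x), hWx, inner_add_right, inner_sub_right,
      inner_smul_right, hstr]
    ring
  -- (ii) the viscous term: `⟪Jx, Δω⟫ = Δ Σ − (2/ρ) DΣ[x_h]`, `Σ = swirl ω`
  have hlap := laplacian_swirl hω2 x
  have hrad := haxω.partialDeriv_eR_swirl (hωd x)
  rw [partialDeriv_apply, eR_eq_inv_smul_horizontal, map_smul, smul_eq_mul] at hrad
  have hvisc : ⟪rotGen x, (Δ (curl u)) x⟫ =
      (Δ (swirl (curl u))) x - 2 / (x 0 ^ 2 + x 1 ^ 2) *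
        fderiv ℝ (swirl (curl u)) x
          ((x 0) • EuclideanSpace.single 0 1 + (x 1) • EuclideanSpace.single 1 1) := by
    have e : fderiv ℝ (curl u) x (EuclideanSpace.single 0 1) 1 -
        fderiv ℝ (curl u) x (EuclideanSpace.single 1 1) 0 =
        1 / (x 0 ^ 2 + x 1 ^ 2) * fderiv ℝ (swirl (curl u)) x
          ((x 0) • EuclideanSpace.single 0 1 + (x 1) • EuclideanSpace.single 1 1) := by
      rw [sq_add_sq_eq_cylRadius_sq]
      have h' : fderiv ℝ (swirl (curl u)) x
          ((x 0) • EuclideanSpace.single 0 1 + (x 1) • EuclideanSpace.single 1 1) =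
          cylRadius x ^ 2 * (fderiv ℝ (curl u) x (EuclideanSpace.single 0 1) 1 -
            fderiv ℝ (curl u) x (EuclideanSpace.single 1 1) 0) := by
        have h2 := congrArg (fun y => cylRadius x * y) hrad
        simp only [] at h2
        rw [← mul_assoc, mul_inv_cancel₀ hx, one_mul] at h2
        rw [h2]
        ring
      rw [h']
      field_simp
    rw [hlap, e]
    ring
  -- (iii) the source: Lagrange `ρ ⟪Ju, ω⟫ = ρW · ρΩ − ρΦ · ρJ`
  have hsrc : ⟪rotGen (u x), curl u x⟫ =
      (x 0 ^ 2 + x 1 ^ 2) * (radVelQuot u x * angVortQuot u x -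
        angVelQuot u x * radVelQuot (curl u) x) := by
    have hL := cylRadius_sq_mul_inner_rotGen x (u x) (curl u x)
    rw [SereginZajaczkowski2007.inner_horizontal_left, SereginZajaczkowski2007.inner_horizontal_left,
      ← hax.cylRadius_sq_mul_radVelQuot hv2 x, ← haxω.cylRadius_sq_mul_radVelQuot hω2 x] at hL
    have e1 : ⟪rotGen x, curl u x⟫ = cylRadius x ^ 2 * angVortQuot u x := by
      rw [hax.cylRadius_sq_mul_angVortQuot hv3 x, swirl_eq_inner_rotGen]
    have e2 : ⟪rotGen x, u x⟫ = cylRadius x ^ 2 * angVelQuot u x := by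
      rw [hax.cylRadius_sq_mul_angVelQuot hv2 x, swirl_eq_inner_rotGen]
    rw [e1, e2] at hL
    rw [sq_add_sq_eq_cylRadius_sq]
    have hr2 : cylRadius x ^ 2 ≠ 0 := pow_ne_zero 2 hx
    apply mul_left_cancel₀ hr2
    rw [hL]
    ring
  -- `Σ = ρ Ω` as functions
  have hSig : swirl (curl u) = fun y => (y 0 ^ 2 + y 1 ^ 2) * angVortQuot u y := by
    funext y
    rw [sq_add_sq_eq_cylRadius_sq, hax.cylRadius_sq_mul_angVortQuot hv3 y]
  rw [hvisc, hsrc, hSig] at hpde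
  -- the template, with `R = 2 ρ (WΩ − ΦJ)`
  have key := template_quotient_eq hΩ hρx (ν := ν)
    (R := 2 * ((x 0 ^ 2 + x 1 ^ 2) * (radVelQuot u x * angVortQuot u x -
      angVelQuot u x * radVelQuot (curl u) x))) (c := u x)
    (σ' := angVelQuot W x) (by linarith [hpde])
  rw [fderiv_apply_horizontal_eq hΩ hΩax, ← sq_add_sq_eq_cylRadius_sq,
    ← hax.cylRadius_sq_mul_radVelQuot hv2 x, ← sq_add_sq_eq_cylRadius_sq] at key
  have e1 : 2 * angVortQuot u x * ((x 0 ^ 2 + x 1 ^ 2) * radVelQuot u x) /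
      (x 0 ^ 2 + x 1 ^ 2) = 2 * radVelQuot u x * angVortQuot u x := by
    field_simp
  have e2 : 2 / (x 0 ^ 2 + x 1 ^ 2) * ((x 0 ^ 2 + x 1 ^ 2) * radDerivQuot (angVortQuot u) x) =
      2 * radDerivQuot (angVortQuot u) x := by
    field_simp
  have e3 : 2 * ((x 0 ^ 2 + x 1 ^ 2) * (radVelQuot u x * angVortQuot u x -
      angVelQuot u x * radVelQuot (curl u) x)) / (x 0 ^ 2 + x 1 ^ 2) =
      2 * (radVelQuot u x * angVortQuot u x - angVelQuot u x * radVelQuot (curl u) x) := by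
    field_simp
  rw [e1, e2, e3] at key
  linarith

/-- **Seregin's `Γ`-equation as an identity of smooth functions on `ℝ³`** (Step 3:
"`∂ₜΓ + (v − 2x'/|x'|²)·∇Γ − ΔΓ + 2(v_θ/r)Φ = 0`", with `∂ₜΓ` rendered by the quotient
`angVelQuot W` of the vorticity right-hand side `W = νΔω − Dω[u] + Du[ω]`): for an axisymmetric
`u ∈ C^∞(ℝ³)`, at EVERY `x`,
`angVelQuot W x + DΓ(x)[u x] = ν (ΔΓ(x) + 2 radDerivQuot Γ x) − 2 angVelQuot u x · Φ(x)`
(`Γ = angVortQuot u`, `Φ = radVelQuot (curl u)`). Off the axis `angVelQuot_vorticityRHS_eq_of_ne`,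
on the axis by continuity of both sides. [cite: Seregin2022LocalAxisym, §2 Step 3 (arXiv:2201.00153 p. 6, the equation of Γ)] -/
theorem angVelQuot_vorticityRHS_eq : ∀ (u : EuclideanSpace ℝ (Fin 3) → EuclideanSpace ℝ (Fin 3)) (ν : ℝ), ContDiff ℝ (⊤ : ℕ∞) u → IsAxisymmetric u → ∀ x : EuclideanSpace ℝ (Fin 3), angVelQuot (fun y => ν • (Δ (curl u)) y - fderiv ℝ (curl u) y (u y) + fderiv ℝ u y (curl u y)) x + fderiv ℝ (angVortQuot u) x (u x) = ν * ((Δ (angVortQuot u)) x + 2 * radDerivQuot (angVortQuot u) x) - 2 * angVelQuot u x * radVelQuot (curl u) x := by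
  intro u ν hu hax x
  have hv4 : ContDiff ℝ 4 u := hu.of_le (by norm_cast)
  have hv5 : ContDiff ℝ 5 u := hu.of_le (by norm_cast)
  have hω : ContDiff ℝ ∞ (curl u) := contDiff_curl (n := ⊤) (by exact_mod_cast hu)
  have hω4 : ContDiff ℝ 4 (curl u) := hω.of_le (by norm_cast)
  have hW : ContDiff ℝ ∞ fun y => ν • (Δ (curl u)) y - fderiv ℝ (curl u) y (u y) +
      fderiv ℝ u y (curl u y) := contDiff_vorticityRHS hu ν
  have hW4 : ContDiff ℝ 4 fun y => ν • (Δ (curl u)) y - fderiv ℝ (curl u) y (u y) +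
      fderiv ℝ u y (curl u y) := hW.of_le (by norm_cast)
  have hΩ2 : ContDiff ℝ 2 (angVortQuot u) := contDiff_angVortQuot (n := 2) hv5
  have hΩ' : ContDiff ℝ 2 (angVelQuot fun y => ν • (Δ (curl u)) y - fderiv ℝ (curl u) y (u y) +
      fderiv ℝ u y (curl u y)) := contDiff_angVelQuot (n := 2) hW4
  have hΦ : ContDiff ℝ 2 (angVelQuot u) := contDiff_angVelQuot (n := 2) hv4
  have hJ : ContDiff ℝ 2 (radVelQuot (curl u)) := contDiff_radVelQuot (n := 2) hω4
  have hL : Continuous fun y => angVelQuot (fun y => ν • (Δ (curl u)) y -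
      fderiv ℝ (curl u) y (u y) + fderiv ℝ u y (curl u y)) y +
      fderiv ℝ (angVortQuot u) y (u y) :=
    hΩ'.continuous.add ((hΩ2.continuous_fderiv two_ne_zero).clm_apply hu.continuous)
  have hR : Continuous fun y => ν * ((Δ (angVortQuot u)) y +
      2 * radDerivQuot (angVortQuot u) y) - 2 * angVelQuot u y * radVelQuot (curl u) y := by
    refine (continuous_const.mul ((continuous_laplacian hΩ2).add
      (continuous_const.mul (continuous_radDerivQuot hΩ2)))).sub ?_
    exact (continuous_const.mul hΦ.continuous).mul hJ.continuous
  refine eq_of_eq_off_ker (EuclideanSpace.proj (0 : Fin 3)) ⟨EuclideanSpace.single 0 1, by simp⟩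
    hL hR (fun z hz => ?_) x
  have hz0 : z 0 ≠ 0 := by simpa using hz
  have hzr : cylRadius z ≠ 0 := fun h => hz0 ((cylRadius_eq_zero_iff z).1 h).1
  exact angVelQuot_vorticityRHS_eq_of_ne hu hax ν hzr

end SliceEquations

end Summit.NavierStokesRegularity.NavierStokesRegularity.Theorems.AxisymmetricKatoGlobal.EulerScaling

end
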